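import Summits.QuantumFields.YangMills.Theorems.GradientFlowWitnessFlowedResponseFloorSlowUnits
import HarnessLib

/-!
# Route `GradientFlowWitness`, crux `FlowedResponseFloor` (stmt-QuantumFields-25684): the crux and BOTH registered
# stubs are EQUIVALENT to their restrictions to pinned / non-slow units (kernel summary of the unit bookkeeping)

Helper file of the prover seat `ym-line-gfw-p1` (gen 3), `--supports stmt-QuantumFields-25684`, R3/RECORD framing.
Three `Iff`s packaging the gen-2 pinning (`unit_pow_le_of_windowFloor`, `unit_pow_le_of_floor`) and the gen-3 slow-unit
discharge (`finiteSize_of_slowUnit`) as statements about the registered Props themselves: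

* `flowedResponseFiniteSize_iff_nonSlow` — `FlowedResponseFiniteSize` (stub 2, «W2 typed once», ALL units) ⟺ the same
  demanded only of units with `¬ ((1 + log β)/(β a(β)⁸) → 0)`;
* `flowedResponseFloorWindow_iff_pinned` — `FlowedResponseFloorWindow` (stub 1) ⟺ the same with the extra conjunct
  «the witness unit is pinned: `a(β)⁸ ≤ C(1 + log β)/β` eventually»;
* `flowedResponseFloor_iff_pinned` — the crux `GradientFlowWitness.FlowedResponseFloor` ⟺ the crux with a pinned witness.

Reading: along the `∃ a` / `∀ a` of the skeleton, everything a unit slower than `((1 + log β)/β)^{1/8}` could contribute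
is settled in the kernel (no floor there; finite-size control automatic there); what remains of 25684 and of both stubs
lives on the pinned units (where the physical `a ≍ e^{−β/(4Nb₀)}` sits) and is the transmutation floor resp. the W2 rate
statement of the prover records.  HONEST FRAMING: equivalences between OPEN statements and bookkeeping only; nothing of
`stub_window`, `stub_finiteSize`, `FlowedResponseFloor`, `BalabanLadder.NT`, any OS leg or the Yang–Mills mass gap is
proved or claimed.
-/

set_option autoImplicit false

noncomputable section

open scoped Topology
open Filter
open Literature.MathematicalPhysics.QuantumFieldTheory hiding ZdEdge
open Literature.MathematicalPhysics.QuantumLattice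

namespace Summit.QuantumFields.YangMills.Cruxes.FlowedResponseFloor.WindowSplit

/-! ## §4 The crux and both stubs are equivalent to their restrictions to the non-slow / pinned units -/

section Restriction

/-- **`stub_finiteSize` ⟺ its restriction to the units that are NOT slow.**  The registered statement
`FlowedResponseFiniteSize` (β-uniform finite-size control of the flowed response for EVERY unit) is equivalent to the
same statement asked only of units with `¬ ((1 + log β)/(β a(β)⁸) → 0)`: the slow ones are discharged by
`finiteSize_of_slowUnit`.  (So the W2 stub's whole content sits on units within `((1 + log β)/β)^{1/8}` of zero along a
subsequence; NOT a proof of the stub.) -/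
theorem flowedResponseFiniteSize_iff_nonSlow :
    FlowedResponseFiniteSize ↔
    ∀ (G : Type) [Group G] [TopologicalSpace G] [IsTopologicalGroup G] [CompactSpace G],
      IsCompactSimpleLieGroup G →
      letI : MeasurableSpace G := borel G
      haveI : BorelSpace G := ⟨rfl⟩
      ∀ (r : LatticeRep G) (a : ℝ → ℝ), (∀ β, 0 < a β) → Tendsto a atTop (nhds 0) →
        ¬ Tendsto (fun β => (1 + Real.log β) / (β * a β ^ 8)) atTop (𝓝 0) →
        ∀ (ρ₀ : ℝ), 0 < ρ₀ → ∀ (w v : SchwartzMap (EuclideanSpace ℝ (Fin 4)) ℝ) (η : ℝ), 0 < η →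
          ∃ Λ₆ β₆ : ℝ, ∀ β : ℝ, β₆ ≤ β → ∀ L L' : ℕ, Λ₆ ≤ a β * L → L ≤ L' →
            |resp G r a ρ₀ w v β L' - resp G r a ρ₀ w v β L| ≤ η := by
  constructor
  · intro h G _ _ _ _ hG
    letI : MeasurableSpace G := borel G
    haveI : BorelSpace G := ⟨rfl⟩
    intro r a ha ha0 _ ρ₀ hρ w v η hη
    exact h G hG r a ha ha0 ρ₀ hρ w v η hη
  · intro h G _ _ _ _ hG
    letI : MeasurableSpace G := borel G
    haveI : BorelSpace G := ⟨rfl⟩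
    intro r a ha ha0 ρ₀ hρ w v η hη
    by_cases hs : Tendsto (fun β => (1 + Real.log β) / (β * a β ^ 8)) atTop (𝓝 0)
    · exact finiteSize_of_slowUnit G r ha hs ρ₀ w v hη
    · exact h G hG r a ha ha0 hs ρ₀ hρ w v η hη

/-- **`stub_window` ⟺ the same with the witness unit PINNED** (`a(β)⁸ ≤ C(1 + log β)/β` for all large `β`, the
gen-2 `unit_pow_le_of_windowFloor`, read at radius `ℓ = 1`): any witness of the window stub lives in the pinned regime,
so the extra conjunct is free.  (NOT a proof of the stub.) -/
theorem flowedResponseFloorWindow_iff_pinned :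
    FlowedResponseFloorWindow ↔
    ∀ (G : Type) [Group G] [TopologicalSpace G] [IsTopologicalGroup G] [CompactSpace G],
      IsCompactSimpleLieGroup G →
      letI : MeasurableSpace G := borel G
      haveI : BorelSpace G := ⟨rfl⟩
      ∃ (r : LatticeRep G) (a : ℝ → ℝ), (∀ β, 0 < a β) ∧ Tendsto a atTop (nhds 0) ∧
        (∃ C β₀ : ℝ, 0 ≤ C ∧ ∀ β : ℝ, β₀ ≤ β → a β ^ 8 ≤ C * (1 + Real.log β) / β) ∧
        ∀ ℓ : ℝ, 0 < ℓ → ∃ (ρ₀ : ℝ) (w v : SchwartzMap (EuclideanSpace ℝ (Fin 4)) ℝ) (ε₁ β₅ Λ₅ : ℝ),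
          0 < ρ₀ ∧ tsupport (v : EuclideanSpace ℝ (Fin 4) → ℝ) ⊆ {y | 0 < y 0} ∧
          tsupport (v : EuclideanSpace ℝ (Fin 4) → ℝ) ⊆ Metric.closedBall 0 ℓ ∧ 0 < ε₁ ∧
          ∀ Λ₆ : ℝ, ∃ β₆ : ℝ, ∀ β : ℝ, β₅ ≤ β → β₆ ≤ β → ∀ L : ℕ, Λ₅ ≤ a β * L → a β * L ≤ Λ₆ →
            ε₁ ≤ |resp G r a ρ₀ w v β L| := by
  constructor
  · intro h G _ _ _ _ hG
    letI : MeasurableSpace G := borel G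
    haveI : BorelSpace G := ⟨rfl⟩
    obtain ⟨r, a, ha, ha0, hwin⟩ := h G hG
    refine ⟨r, a, ha, ha0, ?_, hwin⟩
    obtain ⟨ρ₀, w, v, ε₁, β₅, Λ₅, -, -, -, hε, hW⟩ := hwin 1 one_pos
    exact unit_pow_le_of_windowFloor G r ha ha0 hε hW
  · intro h G _ _ _ _ hG
    letI : MeasurableSpace G := borel G
    haveI : BorelSpace G := ⟨rfl⟩
    obtain ⟨r, a, ha, ha0, -, hwin⟩ := h G hG
    exact ⟨r, a, ha, ha0, hwin⟩

/-- **The crux ⟺ the crux with a PINNED witness unit** (`unit_pow_le_of_floor` at radius `ℓ = 1`): every witness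
`(r, a)` of `FlowedResponseFloor` has `a(β)⁸ ≤ C(1 + log β)/β` for all large `β`; in particular (with
`windowFloor_false_of_slowUnit`) no slow unit — no power law `β^{-c}`, `c < 1/8`, no logarithmic unit — is a witness.
The route decl itself is neither proved nor refuted here. -/
theorem flowedResponseFloor_iff_pinned :
    Summit.QuantumFields.YangMills.Theses.GradientFlowWitness.FlowedResponseFloor ↔
    ∀ (G : Type) [Group G] [TopologicalSpace G] [IsTopologicalGroup G] [CompactSpace G],
      IsCompactSimpleLieGroup G →
      letI : MeasurableSpace G := borel G
      haveI : BorelSpace G := ⟨rfl⟩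
      ∃ (r : LatticeRep G) (a : ℝ → ℝ), (∀ β, 0 < a β) ∧ Tendsto a atTop (nhds 0) ∧
        (∃ C β₀ : ℝ, 0 ≤ C ∧ ∀ β : ℝ, β₀ ≤ β → a β ^ 8 ≤ C * (1 + Real.log β) / β) ∧
        ∀ ℓ : ℝ, 0 < ℓ → ∃ (ρ₀ : ℝ) (w v : SchwartzMap (EuclideanSpace ℝ (Fin 4)) ℝ) (ε₁ β₅ Λ₅ : ℝ),
          0 < ρ₀ ∧ tsupport (v : EuclideanSpace ℝ (Fin 4) → ℝ) ⊆ {y | 0 < y 0} ∧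
          tsupport (v : EuclideanSpace ℝ (Fin 4) → ℝ) ⊆ Metric.closedBall 0 ℓ ∧ 0 < ε₁ ∧
          ∀ β : ℝ, β₅ ≤ β → ∀ L : ℕ, Λ₅ ≤ a β * L → ε₁ ≤ |resp G r a ρ₀ w v β L| := by
  rw [flowedResponseFloor_iff]
  constructor
  · intro h G _ _ _ _ hG
    letI : MeasurableSpace G := borel G
    haveI : BorelSpace G := ⟨rfl⟩
    obtain ⟨r, a, ha, ha0, hfl⟩ := h G hG
    refine ⟨r, a, ha, ha0, ?_, hfl⟩
    obtain ⟨ρ₀, w, v, ε₁, β₅, Λ₅, -, -, -, hε, hF⟩ := hfl 1 one_pos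
    exact unit_pow_le_of_floor G r ha ha0 hε hF
  · intro h G _ _ _ _ hG
    letI : MeasurableSpace G := borel G
    haveI : BorelSpace G := ⟨rfl⟩
    obtain ⟨r, a, ha, ha0, -, hfl⟩ := h G hG
    exact ⟨r, a, ha, ha0, hfl⟩

end Restriction

end Summit.QuantumFields.YangMills.Cruxes.FlowedResponseFloor.WindowSplit

end
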